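/-
Copyright: statement-level skeleton of a published paper (lit-balaban cell, Phase-2 proof seat p13, gen 12). No proof
claims beyond what the kernel checks below.
-/
import Literature.MathematicalPhysics.QuantumFieldTheory.BalabanImbrieJaffe1984to88.BIJ88SecondOrder5133

/-!
# `BalabanImbrieJaffe1984to88.BIJ88PairingAllOrders5133` — T. Bałaban, J. Imbrie, A. Jaffe, *Effective action and cluster
properties of the abelian Higgs model*, Commun. Math. Phys. **114** (1988) 257–315 [BalabanImbrieJaffe1988], §5.13
p. 305 [PDF 49]: **the `s`-derivatives of the interpolated Gaussian integral AT EVERY ORDER, CORRECTLY EVALUATED** —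
the unnormalized counterpart, at all orders `|Γ|`, of the p. 305 pairing display (*"After all derivatives are
performed … The result is …"*, pre-integration-by-parts form of (5.13.3)), with the terms the print omits restored.

For `Γ ⊆ I` and `s` in the unit cube (tree sign `Δ = −Δ_print`; `D_i(s,Φ) = Σ_{l≠i}s_l⟨□_iΦ,Δ□_lΦ⟩`,
`B_{il}(Φ) = ⟨□_iΦ,Δ□_lΦ⟩`):

  `∂/∂s_Γ ∫ H e^{−½⟨Φ,Δ_sΦ⟩}e^{⟨Φ,ℱ⟩}dΦ = ∫ P_Γ(s,Φ) H(Φ) e^{−½⟨Φ,Δ_sΦ⟩}e^{⟨Φ,ℱ⟩}dΦ`,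
  `P_Γ(s,Φ) = Σ_{σ} (−1)^{|σ|} Π_{B∈σ} V_B(s,Φ)`,

the sum running over the set partitions `σ` of `Γ` into blocks of ONE OR TWO cubes (`smallParts Γ`), with
`V_{{i}} = D_i(s,·)` (a derivative that *"brings a new term down"*) and `V_{{i,l}} = B_{il}` (a derivative that *"hits the
factor s_l already pulled down"*).  The print keeps the partitions into blocks of exactly two cubes (the pairings); the
blocks `{i}` — whose factor `D_i(s,·) = Σ_{l∈Γ}s_lB_{il}` at the evaluation point `s_l = 0 (l ∉ Γ)` is NOT zero — are the
omitted terms (kernel witness of the omission: `BIJ88PairingDisplay305.pairingDisplay_fails`; GAPS.md G-C2-24; the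
order-two normalized identity: `BIJ88SecondOrder5133.hasDerivAt_dexpect`).  Equivalently, `P_Γ e^{−½⟨Φ,Δ_sΦ⟩} =
∂_Γ e^{−½⟨Φ,Δ_sΦ⟩}` is the Faà di Bruno expansion of the exponential of the pair polynomial `−Σ_{i<l}s_is_lB_{il}(Φ)`,
whose third `s`-derivatives vanish.

statement-level skeleton of published theorems with citation tags; proofs where landed; nothing here is a claim
about the Yang–Mills mass gap

PDF held: `paper:balaban1988-cmp114-bij-abelian-higgs-effective-action` (journal page = PDF page + 256; p. 305 re-read as
the image `lit-balaban-ref-1/renders/cmp114/original-p049-x2.png`).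

CITATION HEADER (lean-in-tree rule).  lit-balaban cell (HOME `run/shared/lean/pub/lit-balaban/`), Phase 2, seat p13
gen 12; row **C2.Eq5.13.3-5.13.4** of `HOME/lit-balaban-r16/ROWS-C2-part2.md` (owner r16, referee ref-5; the owner's
revised flip condition of 2026-08-22T04:17:58Z *"the p.305 pairing display and (5.13.3) in the CORRECTED form at every
order"* — this file: the corrected form at every order for the unnormalized integral; the normalized/truncated form is
`BIJ88SecondOrder5133` at order two).  USED BY NAME, nothing restated: p13 g12 `BIJ88SecondOrder5133.num`, `Dfun`,
`D_update_eq`, `abs_blockPair_le`, `continuous_blockPair`, `continuous_D`, `integrable_growth_of_lower`; p13 g6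
`BIJ88SDerivative305.hasDerivAt_weight_interp`, `abs_D_le`, `quadForm_interp_ge_near`, `update_mem_cube`; p13 g6
`BIJ88IntegrationByParts305.integrable_tilt`, `continuous_gauss`, `source_eq`, `isSymm_of_posDef`; p02
`BIJ88DirichletDeriv305.blockPair(_comm)`; `Literature.Probability.LatticeModels.setPartitions` with its block
decomposition `HardCoreUrsell.sum_setPartitions_eq_sum_block`.

## What is proved (0 `sorry`, standard axioms, no new `Prop` facts)

* §1 `smallParts Γ` (set partitions into blocks of size ≤ 2), `mem_smallParts`, `smallParts_empty`, `blocks_filter_eq`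
  (the blocks of size ≤ 2 containing a cube `j`: `{j}` and the pairs `{i,j}`), `sum_ite_small_insert`,
  **`sum_smallParts_insert`** (adding a cube:
  `Σ_{σ′∈smallParts(Γ∪j)} g σ′ = Σ_{κ∈smallParts Γ} g({j}∪κ) + Σ_{i∈Γ}Σ_{κ∈smallParts(Γ∖i)} g({i,j}∪κ)`),
  **`sum_smallParts_singletons`** (re-indexing the singleton blocks: `σ ↦ σ∖{{i}}` is a bijection onto `smallParts(Γ∖i)`).
* §2 `bvert` (`V_B`), `dvert` (`∂_jV_B`), `ppoly` (`P_Γ`), `bvert_singleton`, `bvert_pair`, `ppoly_empty` (`P_∅ = 1`),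
  `bvert_update_of_ne_one`, `hasDerivAt_bvert`, `hasDerivAt_prod_bvert`, `sum_blocks_dvert` and
  **`hasDerivAt_ppoly_weight`** — THE POINTWISE RECURSION
  `∂/∂s_j (P_Γ(s,Φ)e^{−½⟨Φ,Δ_sΦ⟩}) = P_{Γ∪j}(s,Φ)e^{−½⟨Φ,Δ_sΦ⟩}` (`Δ` symmetric, `j ∉ Γ`, every `s ∈ ℝ^I`).
* §3 bounds: `continuous_bvert`, `continuous_ppoly`, `abs_bvert_le` (`|V_B(s′,Φ)| ≤ 2(card I)²|C−c|‖Φ‖²` for `|s′| ≤ 2`),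
  **`exists_ppoly_growth`** (`|P_Γ(s[j↦u],Φ)| ≤ K e^{ε‖Φ‖²}` for `s` in the cube, `|u−s_j| ≤ 1`, any `ε > 0`; via the private
  `card_le_of_isSetPartition`, `one_add_mul_pow_le_exp`).
* §4 **`hasDerivAt_num_ppoly`** — THE THEOREM: for `s ∈ [0,1]^I`, `j ∉ Γ`, `H` bounded measurable,
  `∂/∂s_j|_s ∫ P_Γ(s[j↦u],Φ)H dμ_{s[j↦u]} = ∫ P_{Γ∪j}(s,Φ)H dμ_s` (dominated differentiation, p13 g6 style), so that with
  `num_ppoly_empty` (`∫P_∅H dμ_s = N_H(s)`) the family `Γ ↦ ∫P_ΓH dμ_s` is the family of iterated coordinate derivatives of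
  `N_H` on the cube, in the format of p02 `BIJ88FTCExpansion305.ftc_expansion`'s hypothesis `hderiv`.
HONEST SCOPE.  Unnormalized integral (the normalized expectation with its truncations = the cumulants of these moments,
done at order two in `BIJ88SecondOrder5133`, not at all orders here); `H` bounded measurable; real fields, finite
dimension; derivatives along coordinate lines at points of the unit cube (the global packaging on `ℝ^I` is p25's
`BIJ88PolymerRep5134DerivGauss`).  NOT summit progress; NOT continuum; NOT Clay.  Imports `BIJ88SecondOrder5133`;
modifies nothing.
-/

noncomputable section

namespace Literature.MathematicalPhysics.QuantumFieldTheory.BalabanImbrieJaffe1984to88.BIJ88PairingAllOrders5133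

open MeasureTheory Matrix Finset Function Filter Metric
open scoped BigOperators Topology
open Literature.Probability.LatticeModels (setPartitions IsSetPartition mem_setPartitions setPartitions_empty
  isSetPartition_singleton sum_setPartitions_eq_sum_block)
open Literature.MathematicalPhysics.QuantumFieldTheory.Balaban1983to89
open B2Eq228Conditioning (weight source)
open BIJ88DirichletForms305 (interpForm interpForm_posDef)
open BIJ88DirichletDeriv305 (blockPair blockPair_comm)
open BIJ88IntegrationByParts305 (continuous_gauss isSymm_of_posDef source_eq continuous_dotProduct_right)
open BIJ88SDerivative305 (hasDerivAt_weight_interp abs_D_le update_mem_cube quadForm_interp_ge_near)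
open BIJ88SecondOrder5133 (num Dfun D_update_eq abs_blockPair_le continuous_blockPair continuous_D
  integrable_growth_of_lower)

/-! ## §1  Set partitions into blocks of one or two cubes -/

section SmallParts

variable {I : Type} [DecidableEq I]

/-- The set partitions of `Γ` into blocks of one or two cubes — the index set of the corrected pairing display (the
print keeps the blocks of two only). [cite: BalabanImbrieJaffe1988, §5.13 p.305] -/
def smallParts (Γ : Finset I) : Finset (Finset (Finset I)) :=
  (setPartitions Γ).filter fun σ => ∀ B ∈ σ, B.card ≤ 2

/-- membership in `smallParts`. [cite: BalabanImbrieJaffe1988, §5.13 p.305] -/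
theorem mem_smallParts {Γ : Finset I} {σ : Finset (Finset I)} :
    σ ∈ smallParts Γ ↔ IsSetPartition Γ σ ∧ ∀ B ∈ σ, B.card ≤ 2 := by
  rw [smallParts, mem_filter, mem_setPartitions]

/-- `smallParts ∅ = {∅}`. [cite: BalabanImbrieJaffe1988, §5.13 p.305] -/
theorem smallParts_empty : smallParts (∅ : Finset I) = {∅} := by
  rw [smallParts, setPartitions_empty]
  ext σ
  simp only [mem_filter, mem_singleton, and_iff_left_iff_imp]
  rintro rfl
  simp

/-- The blocks of size ≤ 2 of `Γ ∪ {j}` containing the cube `j` are `{j}` and the pairs `{i,j}`, `i ∈ Γ`.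
[cite: BalabanImbrieJaffe1988, §5.13 p.305] -/
theorem blocks_filter_eq (Γ : Finset I) (j : I) :
    ((insert j Γ).powerset.filter fun P => j ∈ P ∧ P.card ≤ 2) = insert {j} (Γ.image fun i => {i, j}) := by
  ext P
  simp only [mem_filter, mem_powerset, mem_insert, mem_image]
  constructor
  · rintro ⟨hsub, hjP, hcard⟩
    have hE : P.erase j ⊆ Γ := fun x hx => by
      have hx' := mem_erase.1 hx
      exact (mem_insert.1 (hsub hx'.2)).resolve_left hx'.1
    have hcardE : (P.erase j).card ≤ 1 := by
      rw [card_erase_of_mem hjP]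
      omega
    by_cases h0 : (P.erase j).card = 0
    · left
      rw [← insert_erase hjP, card_eq_zero.1 h0]
      rfl
    · right
      have h1 : (P.erase j).card = 1 := by omega
      obtain ⟨i, hi⟩ := card_eq_one.1 h1
      refine ⟨i, hE (hi ▸ mem_singleton_self i), ?_⟩
      rw [← insert_erase hjP, hi, pair_comm]
  · rintro (rfl | ⟨i, hi, rfl⟩)
    · exact ⟨singleton_subset_iff.2 (mem_insert_self _ _), mem_singleton_self _, by simp⟩
    · refine ⟨?_, by simp, (card_insert_le _ _).trans (by simp)⟩
      exact insert_subset (mem_insert_of_mem hi) (singleton_subset_iff.2 (mem_insert_self j Γ))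

/-- Inserting a block of size ≤ 2 into the test of smallness. [cite: BalabanImbrieJaffe1988, §5.13 p.305] -/
theorem sum_ite_small_insert {M : Type*} [AddCommMonoid M] (g : Finset (Finset I) → M) {P₀ : Finset I}
    (hP₀ : P₀.card ≤ 2) (V : Finset I) :
    ∑ κ ∈ setPartitions V, (if ∀ B ∈ insert P₀ κ, B.card ≤ 2 then g (insert P₀ κ) else 0)
      = ∑ κ ∈ smallParts V, g (insert P₀ κ) := by
  rw [smallParts, sum_filter]
  refine sum_congr rfl fun κ _ => ?_
  have : (∀ B ∈ insert P₀ κ, B.card ≤ 2) ↔ ∀ B ∈ κ, B.card ≤ 2 := by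
    rw [forall_mem_insert]
    exact ⟨fun h => h.2, fun h => ⟨hP₀, h⟩⟩
  simp only [this]

/-- **Adding a cube.**  For `j ∉ Γ`:
`Σ_{σ′ ∈ smallParts (Γ ∪ {j})} g σ′ = Σ_{κ ∈ smallParts Γ} g ({j} ∪ κ) + Σ_{i∈Γ} Σ_{κ ∈ smallParts (Γ∖{i})} g ({i,j} ∪ κ)` — the
new cube is either a block by itself (a derivative that brings a new term down) or paired with one old cube `i` (a
derivative that hits the factor `s_j` pulled down with `D_i`). [cite: BalabanImbrieJaffe1988, §5.13 p.305] -/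
theorem sum_smallParts_insert {M : Type*} [AddCommMonoid M] {Γ : Finset I} {j : I} (hj : j ∉ Γ)
    (g : Finset (Finset I) → M) :
    ∑ σ ∈ smallParts (insert j Γ), g σ
      = ∑ κ ∈ smallParts Γ, g (insert {j} κ) + ∑ i ∈ Γ, ∑ κ ∈ smallParts (Γ.erase i), g (insert {i, j} κ) := by
  classical
  set G : Finset (Finset I) → M := fun π => if ∀ B ∈ π, B.card ≤ 2 then g π else 0 with hG
  have h1 : ∑ σ ∈ smallParts (insert j Γ), g σ = ∑ π ∈ setPartitions (insert j Γ), G π := by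
    rw [smallParts, sum_filter]
  rw [h1, sum_setPartitions_eq_sum_block (mem_insert_self j Γ) G]
  -- blocks `P₀ ∋ j` of size `> 2` contribute nothing
  have hsplit := (sum_filter_add_sum_filter_not ((insert j Γ).powerset.filter fun P => j ∈ P)
    (fun P => P.card ≤ 2) (fun P₀ => ∑ κ ∈ setPartitions (insert j Γ \ P₀), G (insert P₀ κ))).symm
  rw [hsplit]
  have hzero : ∑ P₀ ∈ ((insert j Γ).powerset.filter fun P => j ∈ P).filter (fun P => ¬ P.card ≤ 2),
      ∑ κ ∈ setPartitions (insert j Γ \ P₀), G (insert P₀ κ) = 0 := by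
    refine sum_eq_zero fun P₀ hP₀ => sum_eq_zero fun κ _ => ?_
    have hc : ¬ P₀.card ≤ 2 := (mem_filter.1 hP₀).2
    simp only [hG]
    rw [if_neg]
    intro h
    exact hc (h P₀ (mem_insert_self _ _))
  rw [hzero, add_zero, filter_filter, blocks_filter_eq Γ j]
  -- the block `{j}` and the pairs `{i,j}`
  have hnot : ({j} : Finset I) ∉ Γ.image (fun i => ({i, j} : Finset I)) := by
    intro h
    obtain ⟨i, hi, hij⟩ := mem_image.1 h
    have : i ∈ ({j} : Finset I) := hij ▸ mem_insert_self i {j}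
    exact hj ((mem_singleton.1 this) ▸ hi)
  have hinj : Set.InjOn (fun i => ({i, j} : Finset I)) Γ := by
    intro i hi i' hi' h
    have hij : i ≠ j := fun e => hj (e ▸ hi)
    have : i ∈ ({i', j} : Finset I) := by
      rw [← show ({i, j} : Finset I) = {i', j} from h]
      exact mem_insert_self i {j}
    rcases mem_insert.1 this with h' | h'
    · exact h'
    · exact absurd (mem_singleton.1 h') hij
  rw [sum_insert hnot, sum_image hinj]
  congr 1
  · rw [show insert j Γ \ {j} = Γ by
      rw [insert_sdiff_of_mem Γ (mem_singleton_self j), sdiff_singleton_eq_erase, erase_eq_of_notMem hj]]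
    simp only [hG]
    exact sum_ite_small_insert g (by simp) Γ
  · refine sum_congr rfl fun i hi => ?_
    have hij : i ≠ j := fun e => hj (e ▸ hi)
    have hset : insert j Γ \ {i, j} = Γ.erase i := by
      rw [sdiff_insert, insert_sdiff_of_mem Γ (mem_singleton_self j), sdiff_singleton_eq_erase,
        erase_eq_of_notMem hj]
    rw [hset]
    simp only [hG]
    exact sum_ite_small_insert g ((card_insert_le _ _).trans (by simp)) (Γ.erase i)

/-- **Re-indexing the singleton blocks.**  `Σ_{σ ∈ smallParts Γ} Σ_{i∈Γ, {i}∈σ} g i (σ ∖ {{i}}) = Σ_{i∈Γ} Σ_{κ ∈ smallParts(Γ∖{i})} g i κ`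
(`σ ↦ σ ∖ {{i}}` is a bijection onto the small partitions of `Γ ∖ {i}`). [cite: BalabanImbrieJaffe1988, §5.13 p.305] -/
theorem sum_smallParts_singletons {M : Type*} [AddCommMonoid M] (Γ : Finset I)
    (g : I → Finset (Finset I) → M) :
    ∑ σ ∈ smallParts Γ, ∑ i ∈ Γ.filter (fun i => {i} ∈ σ), g i (σ.erase {i})
      = ∑ i ∈ Γ, ∑ κ ∈ smallParts (Γ.erase i), g i κ := by
  classical
  have h1 : ∑ σ ∈ smallParts Γ, ∑ i ∈ Γ.filter (fun i => {i} ∈ σ), g i (σ.erase {i})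
      = ∑ σ ∈ smallParts Γ, ∑ i ∈ Γ, if {i} ∈ σ then g i (σ.erase {i}) else 0 := by
    refine sum_congr rfl fun σ _ => ?_
    rw [sum_filter]
  rw [h1, sum_comm]
  refine sum_congr rfl fun i hi => ?_
  rw [← sum_filter]
  have hΓi : Γ \ {i} = Γ.erase i := sdiff_singleton_eq_erase i Γ
  refine sum_nbij' (fun σ => σ.erase {i}) (fun κ => insert {i} κ) ?_ ?_ ?_ ?_ ?_
  · intro σ hσ
    obtain ⟨hσ, hiσ⟩ := mem_filter.1 hσ
    obtain ⟨hP, hsm⟩ := mem_smallParts.1 hσ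
    refine mem_smallParts.2 ⟨?_, fun B hB => hsm B (mem_of_mem_erase hB)⟩
    rw [← hΓi]
    exact hP.erase hiσ
  · intro κ hκ
    obtain ⟨hP, hsm⟩ := mem_smallParts.1 hκ
    rw [← hΓi] at hP
    refine mem_filter.2 ⟨mem_smallParts.2 ⟨hP.insert (singleton_subset_iff.2 hi) (singleton_nonempty i), ?_⟩,
      mem_insert_self _ _⟩
    intro B hB
    rcases mem_insert.1 hB with rfl | hB
    · simp
    · exact hsm B hB
  · intro σ hσ
    exact insert_erase (mem_filter.1 hσ).2
  · intro κ hκ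
    obtain ⟨hP, -⟩ := mem_smallParts.1 hκ
    rw [← hΓi] at hP
    exact erase_insert (hP.notMem_of_sdiff (singleton_nonempty i))
  · intro σ _
    rfl

end SmallParts

/-! ## §2  The corrected pairing polynomial `P_Γ` and its pointwise recursion -/

section Poly

variable {α I : Type} [Fintype α] [DecidableEq α] [Fintype I] [DecidableEq I]
  (blk : α → I) (Δ : Matrix α α ℝ)

/-- The vertex of a block: `V_{{i}}(s,Φ) = D_i(s,Φ) = Σ_{l≠i}s_l⟨□_iΦ,Δ□_lΦ⟩` (one cube: *"bring new terms down"*),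
`V_{{i,l}}(Φ) = ⟨□_iΦ,Δ□_lΦ⟩` (two cubes: *"hit factors s_j already pulled down"*; written symmetrically).
[cite: BalabanImbrieJaffe1988, §5.13 p.305] -/
def bvert (s : I → ℝ) (B : Finset I) (φ : α → ℝ) : ℝ :=
  if B.card = 1 then ∑ i ∈ B, Dfun blk Δ s i φ else (1/2 : ℝ) * ∑ i ∈ B, ∑ l ∈ B.erase i, blockPair blk Δ φ i l

/-- What `∂/∂s_j` does to the vertex of a block: `∂_jD_i = ⟨□_iΦ,Δ□_jΦ⟩` on a one-cube block, `0` on a two-cube block.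
[cite: BalabanImbrieJaffe1988, §5.13 p.305] -/
def dvert (j : I) (B : Finset I) (φ : α → ℝ) : ℝ :=
  if B.card = 1 then ∑ i ∈ B, blockPair blk Δ φ i j else 0

/-- **The corrected pairing polynomial** `P_Γ(s,Φ) = Σ_{σ ∈ smallParts Γ} (−1)^{|σ|} Π_{B∈σ} V_B(s,Φ)`.
[cite: BalabanImbrieJaffe1988, §5.13 p.305] -/
def ppoly (Γ : Finset I) (s : I → ℝ) (φ : α → ℝ) : ℝ :=
  ∑ σ ∈ smallParts Γ, (-1 : ℝ) ^ σ.card * ∏ B ∈ σ, bvert blk Δ s B φ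

/-- one cube: `V_{{i}} = D_i`. [cite: BalabanImbrieJaffe1988, §5.13 p.305] -/
theorem bvert_singleton (s : I → ℝ) (i : I) (φ : α → ℝ) : bvert blk Δ s {i} φ = Dfun blk Δ s i φ := by
  simp [bvert]

/-- two cubes: `V_{{i,l}} = ⟨□_iΦ,Δ□_lΦ⟩` (`Δ` symmetric, `i ≠ l`). [cite: BalabanImbrieJaffe1988, §5.13 p.305] -/
theorem bvert_pair (hΔ : Δ.IsSymm) (s : I → ℝ) {i l : I} (hil : i ≠ l) (φ : α → ℝ) :
    bvert blk Δ s {i, l} φ = blockPair blk Δ φ i l := by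
  have e0 : ({i, l} : Finset I).erase i = {l} := by
    rw [erase_insert (by simpa using hil)]
  have e1 : ({i, l} : Finset I).erase l = {i} := by
    rw [pair_comm, erase_insert (by simpa using hil.symm)]
  rw [bvert, if_neg (by rw [card_pair hil]; norm_num), sum_pair hil, e0, e1, sum_singleton, sum_singleton,
    blockPair_comm blk hΔ φ l i]
  ring

/-- `P_∅ = 1`. [cite: BalabanImbrieJaffe1988, §5.13 p.305] -/
theorem ppoly_empty (s : I → ℝ) (φ : α → ℝ) : ppoly blk Δ ∅ s φ = 1 := by
  simp [ppoly, smallParts_empty]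

/-- A two-cube block's vertex does not depend on `s`. [cite: BalabanImbrieJaffe1988, §5.13 p.305] -/
theorem bvert_update_of_ne_one (s : I → ℝ) (j : I) (u : ℝ) {B : Finset I} (hB : B.card ≠ 1) (φ : α → ℝ) :
    bvert blk Δ (update s j u) B φ = bvert blk Δ s B φ := by
  simp [bvert, hB]

/-- **The `s_j`-derivative of a vertex** of a block `B ⊆ Γ`, `j ∉ Γ`: `∂/∂s_j V_B(s[j↦u]) = dvert_j B`
(`D_i(s[j↦u]) = u⟨□_iΦ,Δ□_jΦ⟩ + D_i(s[j↦0])` on a one-cube block, constant on a two-cube block).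
[cite: BalabanImbrieJaffe1988, §5.13 p.305] -/
theorem hasDerivAt_bvert (s : I → ℝ) {j : I} {B : Finset I} (hjB : j ∉ B) (φ : α → ℝ) (u₀ : ℝ) :
    HasDerivAt (fun u => bvert blk Δ (update s j u) B φ) (dvert blk Δ j B φ) u₀ := by
  by_cases hB : B.card = 1
  · obtain ⟨i, rfl⟩ := card_eq_one.1 hB
    have hij : i ≠ j := fun e => hjB (e ▸ mem_singleton_self i)
    have e1 : (fun u => bvert blk Δ (update s j u) {i} φ)
        = fun u => u * blockPair blk Δ φ i j + Dfun blk Δ (update s j 0) i φ := by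
      funext u
      rw [bvert_singleton]
      simp only [Dfun]
      exact D_update_eq blk Δ s hij u φ
    have e2 : dvert blk Δ j {i} φ = blockPair blk Δ φ i j := by
      simp [dvert]
    rw [e1, e2]
    have hd := ((hasDerivAt_id u₀).mul_const (blockPair blk Δ φ i j)).add_const (Dfun blk Δ (update s j 0) i φ)
    simpa using hd
  · simp only [dvert, if_neg hB]
    simp_rw [bvert_update_of_ne_one blk Δ s j _ hB φ]
    exact hasDerivAt_const u₀ _

/-- The derivative of the product over the blocks of a small partition `σ` of `Γ` (`j ∉ Γ`).
[cite: BalabanImbrieJaffe1988, §5.13 p.305] -/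
theorem hasDerivAt_prod_bvert (s : I → ℝ) {Γ : Finset I} {j : I} (hj : j ∉ Γ) {σ : Finset (Finset I)}
    (hσ : σ ∈ smallParts Γ) (φ : α → ℝ) :
    HasDerivAt (fun u => ∏ B ∈ σ, bvert blk Δ (update s j u) B φ)
      (∑ B ∈ σ, (∏ B' ∈ σ.erase B, bvert blk Δ s B' φ) * dvert blk Δ j B φ) (s j) := by
  have hP := (mem_smallParts.1 hσ).1
  have h := HasDerivAt.fun_finsetProd (u := σ) (x := s j)
    (f := fun B u => bvert blk Δ (update s j u) B φ) (f' := fun B => dvert blk Δ j B φ)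
    (fun B hB => hasDerivAt_bvert blk Δ s (fun hjB => hj (hP.subset hB hjB)) φ (s j))
  simp only [update_eq_self, smul_eq_mul] at h
  exact h

/-- The blocks with a nonzero derivative are the one-cube blocks, indexed by their cube:
`Σ_{B∈σ} (Π_{σ∖B}V)·dvert_jB = Σ_{i∈Γ, {i}∈σ} (Π_{σ∖{i}}V)·⟨□_iΦ,Δ□_jΦ⟩`. [cite: BalabanImbrieJaffe1988, §5.13 p.305] -/
theorem sum_blocks_dvert (s : I → ℝ) {Γ : Finset I} (j : I) {σ : Finset (Finset I)} (hσ : σ ∈ smallParts Γ)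
    (φ : α → ℝ) :
    ∑ B ∈ σ, (∏ B' ∈ σ.erase B, bvert blk Δ s B' φ) * dvert blk Δ j B φ
      = ∑ i ∈ Γ.filter (fun i => {i} ∈ σ), (∏ B' ∈ σ.erase {i}, bvert blk Δ s B' φ) * blockPair blk Δ φ i j := by
  classical
  have hP := (mem_smallParts.1 hσ).1
  -- only one-cube blocks contribute
  rw [← sum_filter_add_sum_filter_not σ (fun B => B.card = 1)]
  have hz : ∑ B ∈ σ.filter (fun B => ¬ B.card = 1), (∏ B' ∈ σ.erase B, bvert blk Δ s B' φ) * dvert blk Δ j B φ = 0 :=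
    sum_eq_zero fun B hB => by rw [dvert, if_neg (mem_filter.1 hB).2, mul_zero]
  rw [hz, add_zero]
  -- one-cube blocks ↔ their cube
  have himg : σ.filter (fun B => B.card = 1) = (Γ.filter fun i => {i} ∈ σ).image fun i => ({i} : Finset I) := by
    ext B
    simp only [mem_filter, mem_image]
    constructor
    · rintro ⟨hB, hc⟩
      obtain ⟨i, rfl⟩ := card_eq_one.1 hc
      exact ⟨i, ⟨hP.subset hB (mem_singleton_self i), hB⟩, rfl⟩
    · rintro ⟨i, ⟨-, hiσ⟩, rfl⟩
      exact ⟨hiσ, card_singleton i⟩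
  rw [himg, sum_image (fun i _ i' _ h => singleton_injective h)]
  refine sum_congr rfl fun i _ => ?_
  rw [dvert, if_pos (card_singleton i), sum_singleton]

variable {blk Δ} in
/-- **THE POINTWISE RECURSION** `∂/∂s_j (P_Γ(s,Φ)·e^{−½⟨Φ,Δ_sΦ⟩}) = P_{Γ∪{j}}(s,Φ)·e^{−½⟨Φ,Δ_sΦ⟩}` (`Δ` symmetric, `j ∉ Γ`, every
`s ∈ ℝ^I`): the derivative either hits the Gaussian (a new one-cube block `{j}`, factor `−D_j`), or a one-cube block
`{i}` of `σ` (which becomes the two-cube block `{i,j}`, factor `⟨□_iΦ,Δ□_jΦ⟩`); two-cube blocks are inert.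
[cite: BalabanImbrieJaffe1988, §5.13 p.305] -/
theorem hasDerivAt_ppoly_weight (hΔ : Δ.IsSymm) (s : I → ℝ) {Γ : Finset I} {j : I} (hj : j ∉ Γ) (φ : α → ℝ) :
    HasDerivAt (fun u => ppoly blk Δ Γ (update s j u) φ * weight (interpForm blk Δ (update s j u)) φ)
      (ppoly blk Δ (insert j Γ) s φ * weight (interpForm blk Δ s) φ) (s j) := by
  classical
  -- derivative of `P_Γ` along `s_j`
  have hP : HasDerivAt (fun u => ppoly blk Δ Γ (update s j u) φ)
      (∑ σ ∈ smallParts Γ, (-1 : ℝ) ^ σ.card *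
        ∑ i ∈ Γ.filter (fun i => {i} ∈ σ), (∏ B' ∈ σ.erase {i}, bvert blk Δ s B' φ) * blockPair blk Δ φ i j) (s j) := by
    have h := HasDerivAt.fun_sum (u := smallParts Γ) (x := s j)
      (A := fun σ u => (-1 : ℝ) ^ σ.card * ∏ B ∈ σ, bvert blk Δ (update s j u) B φ)
      (A' := fun σ => (-1 : ℝ) ^ σ.card *
        ∑ i ∈ Γ.filter (fun i => {i} ∈ σ), (∏ B' ∈ σ.erase {i}, bvert blk Δ s B' φ) * blockPair blk Δ φ i j)
      (fun σ hσ => by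
        have := (hasDerivAt_prod_bvert blk Δ s hj hσ φ).const_mul ((-1 : ℝ) ^ σ.card)
        rwa [sum_blocks_dvert blk Δ s j hσ φ] at this)
    exact h
  -- derivative of the Gaussian weight along `s_j` (p13 g6)
  have hW := hasDerivAt_weight_interp blk hΔ s j φ (s j)
  rw [update_eq_self] at hW
  refine (hP.mul hW).congr_deriv ?_
  rw [update_eq_self]
  -- the recursion for `P`
  have key : ppoly blk Δ (insert j Γ) s φ
      = (∑ σ ∈ smallParts Γ, (-1 : ℝ) ^ σ.card *
          ∑ i ∈ Γ.filter (fun i => {i} ∈ σ), (∏ B' ∈ σ.erase {i}, bvert blk Δ s B' φ) * blockPair blk Δ φ i j)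
        - (∑ l ∈ univ.erase j, s l * blockPair blk Δ φ j l) * ppoly blk Δ Γ s φ := by
    rw [ppoly, sum_smallParts_insert hj]
    -- the `{j}` block: `−D_j · P_Γ`
    have hA : ∑ κ ∈ smallParts Γ, (-1 : ℝ) ^ (insert ({j} : Finset I) κ).card * ∏ B ∈ insert {j} κ, bvert blk Δ s B φ
        = -((∑ l ∈ univ.erase j, s l * blockPair blk Δ φ j l) * ppoly blk Δ Γ s φ) := by
      rw [ppoly, mul_sum, ← sum_neg_distrib]
      refine sum_congr rfl fun κ hκ => ?_
      have hPκ := (mem_smallParts.1 hκ).1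
      have hjκ : ({j} : Finset I) ∉ κ := fun h => hj (hPκ.subset h (mem_singleton_self j))
      rw [card_insert_of_notMem hjκ, prod_insert hjκ, bvert_singleton, pow_succ]
      simp only [Dfun]
      ring
    -- the `{i,j}` blocks: the singleton blocks of `σ` re-indexed
    have hB : ∑ i ∈ Γ, ∑ κ ∈ smallParts (Γ.erase i),
        (-1 : ℝ) ^ (insert ({i, j} : Finset I) κ).card * ∏ B ∈ insert {i, j} κ, bvert blk Δ s B φ
        = ∑ σ ∈ smallParts Γ, (-1 : ℝ) ^ σ.card *
          ∑ i ∈ Γ.filter (fun i => {i} ∈ σ), (∏ B' ∈ σ.erase {i}, bvert blk Δ s B' φ) * blockPair blk Δ φ i j := by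
      have h := sum_smallParts_singletons Γ
        (fun i κ => (-1 : ℝ) ^ (κ.card + 1) * ((∏ B' ∈ κ, bvert blk Δ s B' φ) * blockPair blk Δ φ i j))
      -- left side of `h` is our right side
      have hL : ∑ σ ∈ smallParts Γ, ∑ i ∈ Γ.filter (fun i => {i} ∈ σ),
          (-1 : ℝ) ^ ((σ.erase {i}).card + 1) * ((∏ B' ∈ σ.erase {i}, bvert blk Δ s B' φ) * blockPair blk Δ φ i j)
          = ∑ σ ∈ smallParts Γ, (-1 : ℝ) ^ σ.card *
            ∑ i ∈ Γ.filter (fun i => {i} ∈ σ), (∏ B' ∈ σ.erase {i}, bvert blk Δ s B' φ) * blockPair blk Δ φ i j := by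
        refine sum_congr rfl fun σ _ => ?_
        rw [mul_sum]
        refine sum_congr rfl fun i hi => ?_
        rw [card_erase_add_one (mem_filter.1 hi).2]
      -- right side of `h` is our left side
      have hR : ∑ i ∈ Γ, ∑ κ ∈ smallParts (Γ.erase i),
          (-1 : ℝ) ^ (κ.card + 1) * ((∏ B' ∈ κ, bvert blk Δ s B' φ) * blockPair blk Δ φ i j)
          = ∑ i ∈ Γ, ∑ κ ∈ smallParts (Γ.erase i),
            (-1 : ℝ) ^ (insert ({i, j} : Finset I) κ).card * ∏ B ∈ insert {i, j} κ, bvert blk Δ s B φ := by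
        refine sum_congr rfl fun i hi => sum_congr rfl fun κ hκ => ?_
        have hPκ := (mem_smallParts.1 hκ).1
        have hij : i ≠ j := fun e => hj (e ▸ hi)
        have hijκ : ({i, j} : Finset I) ∉ κ := fun h =>
          (notMem_erase i Γ) (hPκ.subset h (mem_insert_self i {j}))
        rw [card_insert_of_notMem hijκ, prod_insert hijκ, bvert_pair blk Δ hΔ s hij]
        ring
      rw [← hR, ← h, hL]
    rw [hA, hB]
    ring
  rw [key]
  ring

end Poly

/-! ## §3  Continuity and growth of `P_Γ` -/

section Bounds

variable {α I : Type} [Fintype α] [DecidableEq α] [Fintype I] [DecidableEq I]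
  (blk : α → I) (Δ : Matrix α α ℝ)

/-- `Φ ↦ V_B(s,Φ)` is continuous. [cite: BalabanImbrieJaffe1988, §5.13 p.305] -/
theorem continuous_bvert (s : I → ℝ) (B : Finset I) : Continuous fun φ : α → ℝ => bvert blk Δ s B φ := by
  unfold bvert
  split_ifs
  · exact continuous_finsetSum _ fun i _ => continuous_D blk Δ s i
  · exact continuous_const.mul (continuous_finsetSum _ fun i _ =>
      continuous_finsetSum _ fun l _ => continuous_blockPair blk Δ i l)

/-- `Φ ↦ P_Γ(s,Φ)` is continuous. [cite: BalabanImbrieJaffe1988, §5.13 p.305] -/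
theorem continuous_ppoly (Γ : Finset I) (s : I → ℝ) : Continuous fun φ : α → ℝ => ppoly blk Δ Γ s φ :=
  continuous_finsetSum _ fun _ _ => continuous_const.mul (continuous_finsetProd _ fun B _ => continuous_bvert blk Δ s B)

omit [Fintype α] [DecidableEq α] [Fintype I] in
/-- A set partition has at most as many blocks as points. [folklore] -/
private theorem card_le_of_isSetPartition {Γ : Finset I} {σ : Finset (Finset I)} (h : IsSetPartition Γ σ) :
    σ.card ≤ Γ.card := by
  rw [← h.sum_card, card_eq_sum_ones]
  exact sum_le_sum fun B hB => card_pos.2 (h.nonempty_of_mem hB)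

/-- **Quadratic growth of the vertices**: with form bounds `c‖v‖² ≤ ⟨v,Δv⟩ ≤ C‖v‖²` (`Δ` symmetric) and parameters
`|s′_l| ≤ 2`, `|V_B(s′,Φ)| ≤ 2(card I)²|C−c|·‖Φ‖²` for every `B`. [cite: BalabanImbrieJaffe1988, §5.13 p.305] -/
theorem abs_bvert_le (hΔ : Δ.IsSymm) {c C : ℝ} (hcΔ : ∀ v, c * (v ⬝ᵥ v) ≤ v ⬝ᵥ (Δ *ᵥ v))
    (hCΔ : ∀ v, v ⬝ᵥ (Δ *ᵥ v) ≤ C * (v ⬝ᵥ v)) {s' : I → ℝ} (hs' : ∀ l, |s' l| ≤ 2) (B : Finset I) (φ : α → ℝ) :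
    |bvert blk Δ s' B φ| ≤ 2 * (Fintype.card I : ℝ) ^ 2 * |C - c| * (φ ⬝ᵥ φ) := by
  have hn : 0 ≤ φ ⬝ᵥ φ := Finset.sum_nonneg fun x _ => mul_self_nonneg (φ x)
  have hK : 0 ≤ |C - c| := abs_nonneg _
  set N : ℝ := (Fintype.card I : ℝ) with hN
  have hN0 : 0 ≤ N := by positivity
  have hBpair : ∀ i : I, ∀ l ∈ (univ : Finset I).erase i, |blockPair blk Δ φ i l| ≤ |C - c| / 2 * (φ ⬝ᵥ φ) :=
    fun i l hl => abs_blockPair_le blk hΔ hcΔ hCΔ (Finset.ne_of_mem_erase hl).symm φ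
  unfold bvert
  split_ifs with hB
  · -- one cube: `|D_i(s′)| ≤ Σ_{l≠i}|s′_l||B_il| ≤ card I · |C−c| ‖Φ‖²`
    obtain ⟨i, rfl⟩ := card_eq_one.1 hB
    rw [sum_singleton, Dfun]
    have h1 : |∑ l ∈ univ.erase i, s' l * blockPair blk Δ φ i l| ≤ ∑ l ∈ univ.erase i, 2 * (|C - c| / 2 * (φ ⬝ᵥ φ)) := by
      refine (abs_sum_le_sum_abs _ _).trans (sum_le_sum fun l hl => ?_)
      rw [abs_mul]
      exact mul_le_mul (hs' l) (hBpair i l hl) (abs_nonneg _) (by norm_num)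
    have h2 : ∑ l ∈ univ.erase i, 2 * (|C - c| / 2 * (φ ⬝ᵥ φ)) ≤ N * (|C - c| * (φ ⬝ᵥ φ)) := by
      rw [sum_const, nsmul_eq_mul]
      have hc' : ((univ.erase i).card : ℝ) ≤ N := by
        rw [hN]
        exact_mod_cast (card_le_univ _)
      nlinarith [mul_nonneg hK hn]
    have h3 : N * (|C - c| * (φ ⬝ᵥ φ)) ≤ 2 * N ^ 2 * |C - c| * (φ ⬝ᵥ φ) := by
      have hN1 : 1 ≤ N := by
        rw [hN]
        exact_mod_cast Fintype.card_pos_iff.2 ⟨i⟩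
      nlinarith [mul_nonneg hK hn, mul_nonneg (mul_nonneg hN0 hK) hn]
    linarith
  · -- two (or more) cubes: `½ΣΣ|B_il| ≤ ¼ (card B)² |C−c| ‖Φ‖²`
    rw [abs_mul, abs_of_pos (by norm_num : (0:ℝ) < 1/2)]
    have h1 : |∑ i ∈ B, ∑ l ∈ B.erase i, blockPair blk Δ φ i l| ≤ ∑ i ∈ B, ∑ l ∈ B.erase i, |C - c| / 2 * (φ ⬝ᵥ φ) := by
      refine (abs_sum_le_sum_abs _ _).trans (sum_le_sum fun i _ => (abs_sum_le_sum_abs _ _).trans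
        (sum_le_sum fun l hl => ?_))
      exact hBpair i l (mem_erase.2 ⟨(mem_erase.1 hl).1, mem_univ l⟩)
    have h2 : ∑ i ∈ B, ∑ l ∈ B.erase i, |C - c| / 2 * (φ ⬝ᵥ φ) ≤ N * (N * (|C - c| / 2 * (φ ⬝ᵥ φ))) := by
      have hBN : (B.card : ℝ) ≤ N := by
        rw [hN]
        exact_mod_cast card_le_univ B
      calc ∑ i ∈ B, ∑ l ∈ B.erase i, |C - c| / 2 * (φ ⬝ᵥ φ)
          ≤ ∑ i ∈ B, N * (|C - c| / 2 * (φ ⬝ᵥ φ)) := sum_le_sum fun i _ => by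
            rw [sum_const, nsmul_eq_mul]
            have : ((B.erase i).card : ℝ) ≤ N := le_trans (by exact_mod_cast card_erase_le) hBN
            exact mul_le_mul_of_nonneg_right this (by positivity)
        _ = B.card * (N * (|C - c| / 2 * (φ ⬝ᵥ φ))) := by rw [sum_const, nsmul_eq_mul]
        _ ≤ N * (N * (|C - c| / 2 * (φ ⬝ᵥ φ))) := mul_le_mul_of_nonneg_right hBN (by positivity)
    nlinarith [mul_nonneg hK hn, mul_nonneg (mul_nonneg hN0 hN0) (mul_nonneg hK hn)]

omit [Fintype α] [DecidableEq α] [Fintype I] [DecidableEq I] in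
/-- `(1 + Kx)ⁿ ≤ (1 + K/δ)ⁿ e^{nδx}` for `x, K ≥ 0`, `δ > 0`. [folklore] -/
private theorem one_add_mul_pow_le_exp {K δ x : ℝ} (hK : 0 ≤ K) (hδ : 0 < δ) (hx : 0 ≤ x) (n : ℕ) :
    (1 + K * x) ^ n ≤ (1 + K / δ) ^ n * Real.exp (n * (δ * x)) := by
  have h1 : (1 : ℝ) ≤ Real.exp (δ * x) := Real.one_le_exp (by positivity)
  have h2 : x ≤ Real.exp (δ * x) / δ := by
    rw [le_div_iff₀ hδ]
    have := Real.add_one_le_exp (δ * x)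
    nlinarith
  have h3 : 1 + K * x ≤ (1 + K / δ) * Real.exp (δ * x) := by
    have : K * x ≤ K / δ * Real.exp (δ * x) := by
      calc K * x ≤ K * (Real.exp (δ * x) / δ) := mul_le_mul_of_nonneg_left h2 hK
        _ = K / δ * Real.exp (δ * x) := by ring
    linarith
  calc (1 + K * x) ^ n ≤ ((1 + K / δ) * Real.exp (δ * x)) ^ n := pow_le_pow_left₀ (by positivity) h3 n
    _ = (1 + K / δ) ^ n * Real.exp (n * (δ * x)) := by rw [mul_pow, ← Real.exp_nat_mul]

/-- **Gaussian growth of `P_Γ` near the cube**: for `s ∈ [0,1]^I`, `|u − s_j| ≤ 1` and any `ε > 0` there is `K` (uniform in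
such `u` and in `Φ`) with `|P_Γ(s[j↦u],Φ)| ≤ K e^{ε‖Φ‖²}`. [cite: BalabanImbrieJaffe1988, §5.13 p.305] -/
theorem exists_ppoly_growth (hΔ : Δ.IsSymm) {c C : ℝ} (hcΔ : ∀ v, c * (v ⬝ᵥ v) ≤ v ⬝ᵥ (Δ *ᵥ v))
    (hCΔ : ∀ v, v ⬝ᵥ (Δ *ᵥ v) ≤ C * (v ⬝ᵥ v)) {s : I → ℝ} (hs : ∀ l, 0 ≤ s l ∧ s l ≤ 1) (j : I) (Γ : Finset I)
    {ε : ℝ} (hε : 0 < ε) :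
    ∃ K : ℝ, ∀ u : ℝ, |u - s j| ≤ 1 → ∀ φ : α → ℝ, |ppoly blk Δ Γ (update s j u) φ| ≤ K * Real.exp (ε * (φ ⬝ᵥ φ)) := by
  set K₁ : ℝ := 2 * (Fintype.card I : ℝ) ^ 2 * |C - c| with hK₁
  have hK₁0 : 0 ≤ K₁ := by positivity
  set n : ℕ := Γ.card with hn
  set δ : ℝ := ε / (n + 1) with hδ
  have hδ0 : 0 < δ := by positivity
  refine ⟨(smallParts Γ).card * (1 + K₁ / δ) ^ n, fun u hu φ => ?_⟩
  have hx : 0 ≤ φ ⬝ᵥ φ := Finset.sum_nonneg fun x _ => mul_self_nonneg (φ x)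
  have hs' : ∀ l, |update s j u l| ≤ 2 := fun l => by
    rcases eq_or_ne l j with rfl | hl
    · rw [update_self]
      have h1 : |u| ≤ |u - s l| + |s l| := by
        have := abs_add_le (u - s l) (s l)
        rwa [sub_add_cancel] at this
      have h2 : |s l| ≤ 1 := abs_le.2 ⟨by linarith [(hs l).1], (hs l).2⟩
      linarith
    · rw [update_of_ne hl]
      have h2 : |s l| ≤ 1 := abs_le.2 ⟨by linarith [(hs l).1], (hs l).2⟩
      linarith
  -- each term: `|(−1)^{|σ|} Π V_B| ≤ (K₁x)^{|σ|} ≤ (1 + K₁x)^n`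
  have hterm : ∀ σ ∈ smallParts Γ, |(-1 : ℝ) ^ σ.card * ∏ B ∈ σ, bvert blk Δ (update s j u) B φ|
      ≤ (1 + K₁ * (φ ⬝ᵥ φ)) ^ n := by
    intro σ hσ
    rw [abs_mul, abs_pow, abs_neg, abs_one, one_pow, one_mul, Finset.abs_prod]
    calc ∏ B ∈ σ, |bvert blk Δ (update s j u) B φ|
        ≤ ∏ B ∈ σ, K₁ * (φ ⬝ᵥ φ) := prod_le_prod (fun B _ => abs_nonneg _)
            (fun B _ => abs_bvert_le blk Δ hΔ hcΔ hCΔ hs' B φ)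
      _ = (K₁ * (φ ⬝ᵥ φ)) ^ σ.card := prod_const _
      _ ≤ (1 + K₁ * (φ ⬝ᵥ φ)) ^ σ.card := pow_le_pow_left₀ (by positivity) (by linarith) _
      _ ≤ (1 + K₁ * (φ ⬝ᵥ φ)) ^ n :=
            pow_le_pow_right₀ (by nlinarith) (card_le_of_isSetPartition (mem_smallParts.1 hσ).1)
  have hsum : |ppoly blk Δ Γ (update s j u) φ| ≤ (smallParts Γ).card * (1 + K₁ * (φ ⬝ᵥ φ)) ^ n := by
    rw [ppoly]
    refine (abs_sum_le_sum_abs _ _).trans ?_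
    have := sum_le_sum hterm
    rwa [sum_const, nsmul_eq_mul] at this
  have hpow := one_add_mul_pow_le_exp hK₁0 hδ0 hx n
  have hexp : Real.exp (n * (δ * (φ ⬝ᵥ φ))) ≤ Real.exp (ε * (φ ⬝ᵥ φ)) := by
    rw [Real.exp_le_exp]
    have hnδ : (n : ℝ) * δ ≤ ε := by
      rw [hδ, mul_div_assoc']
      rw [div_le_iff₀ (by positivity)]
      nlinarith
    nlinarith
  calc |ppoly blk Δ Γ (update s j u) φ| ≤ (smallParts Γ).card * (1 + K₁ * (φ ⬝ᵥ φ)) ^ n := hsum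
    _ ≤ (smallParts Γ).card * ((1 + K₁ / δ) ^ n * Real.exp (n * (δ * (φ ⬝ᵥ φ)))) :=
        mul_le_mul_of_nonneg_left hpow (by positivity)
    _ ≤ (smallParts Γ).card * ((1 + K₁ / δ) ^ n * Real.exp (ε * (φ ⬝ᵥ φ))) :=
        mul_le_mul_of_nonneg_left (mul_le_mul_of_nonneg_left hexp (by positivity)) (by positivity)
    _ = _ := by ring

end Bounds

/-! ## §4  The theorem: `∂/∂s_Γ ∫H dμ_s = ∫ P_Γ H dμ_s` at every order -/

section Main

variable {α I : Type} [Fintype α] [DecidableEq α] [Fintype I] [DecidableEq I] (blk : α → I)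
  {Δ : Matrix α α ℝ} (hΔ : Δ.PosDef) {c C : ℝ} (hc : 0 < c)
  (hcΔ : ∀ v, c * (v ⬝ᵥ v) ≤ v ⬝ᵥ (Δ *ᵥ v)) (hCΔ : ∀ v, v ⬝ᵥ (Δ *ᵥ v) ≤ C * (v ⬝ᵥ v))
  {s : I → ℝ} (hs : ∀ l, 0 ≤ s l ∧ s l ≤ 1) {Γ : Finset I} {j : I} (hj : j ∉ Γ) (f : α → ℝ)
  {H : (α → ℝ) → ℝ} (hHm : AEStronglyMeasurable H volume) {K₀ : ℝ} (hK : ∀ φ, ‖H φ‖ ≤ K₀)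

/-- At order zero the family starts with `N_H`: `∫ P_∅ H dμ_s = ∫ H dμ_s`. [cite: BalabanImbrieJaffe1988, §5.13 p.305] -/
theorem num_ppoly_empty (Δ : Matrix α α ℝ) (f : α → ℝ) (H : (α → ℝ) → ℝ) (s : I → ℝ) :
    num blk Δ f (fun φ => ppoly blk Δ ∅ s φ * H φ) s = num blk Δ f H s := by
  simp [num, ppoly_empty]

include hΔ hc hcΔ hCΔ hs hj hHm hK in
/-- **THE `s`-DERIVATIVES AT EVERY ORDER** (the corrected pairing display, unnormalized): for `s ∈ [0,1]^I`, `j ∉ Γ`, `H`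
bounded measurable,
`∂/∂s_j|_s ∫ P_Γ(s[j↦u],Φ) H(Φ) e^{−½⟨Φ,Δ_{s[j↦u]}Φ⟩}e^{⟨Φ,ℱ⟩}dΦ = ∫ P_{Γ∪{j}}(s,Φ) H(Φ) e^{−½⟨Φ,Δ_sΦ⟩}e^{⟨Φ,ℱ⟩}dΦ`;
with `num_ppoly_empty`, `Γ ↦ ∫P_ΓH dμ_s` is the family of iterated coordinate derivatives of `N_H = ∫H dμ_s` on the cube,
`P_Γ = Σ_{σ∈smallParts Γ}(−1)^{|σ|}Π_{B∈σ}V_B` — the print's pairings are the `σ` with two-cube blocks only.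
[cite: BalabanImbrieJaffe1988, §5.13 p.305] -/
theorem hasDerivAt_num_ppoly :
    HasDerivAt (fun u => num blk Δ f (fun φ => ppoly blk Δ Γ (update s j u) φ * H φ) (update s j u))
      (num blk Δ f (fun φ => ppoly blk Δ (insert j Γ) s φ * H φ) s) (s j) := by
  have hΔs : Δ.IsSymm := isSymm_of_posDef hΔ
  have hK0 : 0 ≤ K₀ := (norm_nonneg _).trans (hK 0)
  have hsj : 0 ≤ s j ∧ s j ≤ 1 := hs j
  have hε8 : 0 < c / 8 := by positivity
  -- growth constants for `P_Γ` and `P_{Γ∪j}` near the cube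
  obtain ⟨KΓ, hKΓ⟩ := exists_ppoly_growth blk Δ hΔs hcΔ hCΔ hs j Γ hε8
  obtain ⟨KΓ', hKΓ'⟩ := exists_ppoly_growth blk Δ hΔs hcΔ hCΔ hs j (insert j Γ) hε8
  have hKΓ'0 : 0 ≤ KΓ' := by
    have h := hKΓ' (s j) (by simp) 0
    simp only [dotProduct_zero, mul_zero, Real.exp_zero, mul_one] at h
    exact (abs_nonneg _).trans h
  -- radius: coercivity `⟨Φ,Δ_{s[j↦u]}Φ⟩ ≥ (c/2)‖Φ‖²` (p13 g6) and `|u − s_j| ≤ 1`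
  set r : ℝ := min (c / (2 * |C - c| + c)) 1 with hr
  have hr0 : 0 < r := lt_min (by positivity) one_pos
  have hru : ∀ u ∈ ball (s j) r, |u - s j| ≤ c / (2 * |C - c| + c) ∧ |u - s j| ≤ 1 := fun u hu => by
    rw [mem_ball, Real.dist_eq] at hu
    exact ⟨(hu.trans_le (min_le_left _ _)).le, (hu.trans_le (min_le_right _ _)).le⟩
  -- continuity / measurability
  have hwc : ∀ u : ℝ, Continuous fun φ : α → ℝ => weight (interpForm blk Δ (update s j u)) φ := fun u =>
    continuous_gauss _
  have hsc : Continuous fun φ : α → ℝ => source f φ :=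
    (continuous_dotProduct_right f).rexp.congr fun φ => (source_eq f φ).symm
  have hmeas : ∀ (Γ₀ : Finset I) (u : ℝ), AEStronglyMeasurable (fun φ : α → ℝ =>
      ppoly blk Δ Γ₀ (update s j u) φ * weight (interpForm blk Δ (update s j u)) φ * (H φ * source f φ)) volume :=
    fun Γ₀ u => (((continuous_ppoly blk Δ Γ₀ _).mul (hwc u)).aestronglyMeasurable).mul (hHm.mul hsc.aestronglyMeasurable)
  -- the hypotheses of dominated differentiation
  have hF_meas : ∀ᶠ u in 𝓝 (s j), AEStronglyMeasurable (fun φ : α → ℝ =>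
      ppoly blk Δ Γ (update s j u) φ * weight (interpForm blk Δ (update s j u)) φ * (H φ * source f φ)) volume :=
    Eventually.of_forall fun u => hmeas Γ u
  have hgrowth : ∀ (Γ₀ : Finset I) (KK : ℝ), (∀ φ : α → ℝ, |ppoly blk Δ Γ₀ s φ| ≤ KK * Real.exp (c / 8 * (φ ⬝ᵥ φ))) →
      Integrable fun φ : α → ℝ =>
        ppoly blk Δ Γ₀ s φ * weight (interpForm blk Δ s) φ * (H φ * source f φ) := by
    intro Γ₀ KK hKK
    have hGm : AEStronglyMeasurable (fun φ : α → ℝ => ppoly blk Δ Γ₀ s φ * H φ) volume :=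
      (continuous_ppoly blk Δ Γ₀ s).aestronglyMeasurable.mul hHm
    have hG : ∀ φ : α → ℝ, ‖ppoly blk Δ Γ₀ s φ * H φ‖ ≤ KK * K₀ * Real.exp (c / 8 * (φ ⬝ᵥ φ)) := fun φ => by
      rw [norm_mul, Real.norm_eq_abs]
      calc |ppoly blk Δ Γ₀ s φ| * ‖H φ‖ ≤ KK * Real.exp (c / 8 * (φ ⬝ᵥ φ)) * K₀ :=
            mul_le_mul (hKK φ) (hK φ) (norm_nonneg _) ((abs_nonneg _).trans (hKK φ))
        _ = KK * K₀ * Real.exp (c / 8 * (φ ⬝ᵥ φ)) := by ring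
    have hI := integrable_growth_of_lower (BIJ88DirichletForms305.quadForm_interpForm_ge blk hcΔ hs) f hGm
      (by linarith : 2 * (c / 8) < c) hG
    exact hI.congr (Eventually.of_forall fun φ => by ring)
  have hF_int : Integrable (fun φ : α → ℝ =>
      ppoly blk Δ Γ (update s j (s j)) φ * weight (interpForm blk Δ (update s j (s j))) φ * (H φ * source f φ)) := by
    simp only [update_eq_self]
    exact hgrowth Γ KΓ fun φ => by simpa using hKΓ (s j) (by simp) φ
  have hF'_meas : AEStronglyMeasurable (fun φ : α → ℝ =>
      ppoly blk Δ (insert j Γ) (update s j (s j)) φ * weight (interpForm blk Δ (update s j (s j))) φ *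
        (H φ * source f φ)) volume := hmeas (insert j Γ) (s j)
  have h_diff : ∀ᵐ φ ∂(volume : Measure (α → ℝ)), ∀ u ∈ ball (s j) r,
      HasDerivAt (fun u => ppoly blk Δ Γ (update s j u) φ * weight (interpForm blk Δ (update s j u)) φ *
          (H φ * source f φ))
        (ppoly blk Δ (insert j Γ) (update s j u) φ * weight (interpForm blk Δ (update s j u)) φ *
          (H φ * source f φ)) u := by
    refine Eventually.of_forall fun φ u _ => ?_
    have h := hasDerivAt_ppoly_weight (blk := blk) (Δ := Δ) hΔs (update s j u) hj φ
    simp only [update_idem, update_self] at h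
    exact h.mul_const _
  -- the dominating function `KΓ′ K₀ e^{⟨Φ,ℱ⟩} e^{−(c/8)‖Φ‖²}`
  have hA' : ((c / 4) • (1 : Matrix α α ℝ)).PosDef := Matrix.PosDef.one.smul (by positivity)
  have bound_integrable : Integrable fun φ : α → ℝ => KΓ' * K₀ *
      (Real.exp (φ ⬝ᵥ f) * Real.exp (-(1/2 : ℝ) * (φ ⬝ᵥ ((c / 4) • (1 : Matrix α α ℝ)) *ᵥ φ))) :=
    (BIJ88IntegrationByParts305.integrable_tilt hA' f).const_mul _
  have h_bound : ∀ᵐ φ ∂(volume : Measure (α → ℝ)), ∀ u ∈ ball (s j) r,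
      ‖ppoly blk Δ (insert j Γ) (update s j u) φ * weight (interpForm blk Δ (update s j u)) φ * (H φ * source f φ)‖
        ≤ KΓ' * K₀ * (Real.exp (φ ⬝ᵥ f) * Real.exp (-(1/2 : ℝ) * (φ ⬝ᵥ ((c / 4) • (1 : Matrix α α ℝ)) *ᵥ φ))) := by
    refine Eventually.of_forall fun φ u hu => ?_
    obtain ⟨hu1, hu2⟩ := hru u hu
    have hx : 0 ≤ φ ⬝ᵥ φ := Finset.sum_nonneg fun x _ => mul_self_nonneg (φ x)
    have hQ := quadForm_interp_ge_near blk hc hcΔ hCΔ hs j hsj hu1 φ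
    have hw0 : 0 ≤ weight (interpForm blk Δ (update s j u)) φ := (B2Eq228Conditioning.weight_pos _ φ).le
    have hw : weight (interpForm blk Δ (update s j u)) φ * Real.exp (c / 8 * (φ ⬝ᵥ φ))
        ≤ Real.exp (-(1/2 : ℝ) * (φ ⬝ᵥ ((c / 4) • (1 : Matrix α α ℝ)) *ᵥ φ)) := by
      rw [B2Eq228Conditioning.weight, ← Real.exp_add, Real.exp_le_exp, Matrix.smul_mulVec, Matrix.one_mulVec,
        dotProduct_smul, smul_eq_mul]
      nlinarith
    have hP := hKΓ' u hu2 φ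
    rw [norm_mul, norm_mul, norm_mul, Real.norm_eq_abs, Real.norm_of_nonneg hw0, source_eq,
      Real.norm_of_nonneg (Real.exp_pos _).le]
    calc |ppoly blk Δ (insert j Γ) (update s j u) φ| * weight (interpForm blk Δ (update s j u)) φ *
          (‖H φ‖ * Real.exp (φ ⬝ᵥ f))
        ≤ KΓ' * Real.exp (c / 8 * (φ ⬝ᵥ φ)) * weight (interpForm blk Δ (update s j u)) φ *
          (K₀ * Real.exp (φ ⬝ᵥ f)) := by
          gcongr
          exact hK φ
      _ = KΓ' * K₀ * (Real.exp (φ ⬝ᵥ f) * (weight (interpForm blk Δ (update s j u)) φ * Real.exp (c / 8 * (φ ⬝ᵥ φ)))) := by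
          ring
      _ ≤ KΓ' * K₀ * (Real.exp (φ ⬝ᵥ f) * Real.exp (-(1/2 : ℝ) * (φ ⬝ᵥ ((c / 4) • (1 : Matrix α α ℝ)) *ᵥ φ))) := by
          gcongr
  have key := hasDerivAt_integral_of_dominated_loc_of_deriv_le (ball_mem_nhds (s j) hr0) hF_meas hF_int hF'_meas
    h_bound bound_integrable h_diff
  -- back to the `num` notation
  have e1 : (fun u => num blk Δ f (fun φ => ppoly blk Δ Γ (update s j u) φ * H φ) (update s j u))
      = fun u => ∫ φ : α → ℝ, ppoly blk Δ Γ (update s j u) φ * weight (interpForm blk Δ (update s j u)) φ *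
          (H φ * source f φ) := by
    funext u
    rw [num]
    congr 1
    funext φ
    ring
  have e2 : num blk Δ f (fun φ => ppoly blk Δ (insert j Γ) s φ * H φ) s
      = ∫ φ : α → ℝ, ppoly blk Δ (insert j Γ) (update s j (s j)) φ *
          weight (interpForm blk Δ (update s j (s j))) φ * (H φ * source f φ) := by
    rw [num, update_eq_self]
    congr 1
    funext φ
    ring
  rw [e1, e2]
  exact key.2

end Main

end Literature.MathematicalPhysics.QuantumFieldTheory.BalabanImbrieJaffe1984to88.BIJ88PairingAllOrders5133
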